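import Mathlib
import Summits.NavierStokesRegularity.NavierStokesRegularity.Theorems.TaoLadderRungTwoBreakOneShiftWindowReduction
import Summits.NavierStokesRegularity.NavierStokesRegularity.Theorems.TaoLadderRungTwoBreakOneShiftQuadTermBound
import HarnessLib

/-!
# The one-shift Banach argument with TABLE-SPARSE rate rows (`v3s`, `v4s`)

`exists_surviving_dssWave_of_windowCert_v3` / `_v4` take the rate rows in the norm form
`m² M_α (Λ^k (A_k² + 2 A_k A_{k+1}) + Λ^{k-1} A_{k-1}²) ≤ R k`.  For the STAGE-2 certificates of the cell this is
too crude by a factor `≈ 20` (the wake self-map rows compare the radius growth `τ_hi R` per shift with the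
allowance `κ ≈ 10⁻⁴`).  Here the same two theorems are restated with the table-sparse rate rows
`quadTermLip ε₀ α A A i k ≤ 2 R k` (tail shells `k`), justified by `two_mul_abs_quadTerm_le_quadTermLip`;
everything else is verbatim.  Model lattice only (Tao-type averaged cascade); nothing here is about
Navier–Stokes. [cite: Tao2016AveragedNS, §4 Lemma 4.1 (4.8), §5.3–§6; cell vocabulary, harvest/h2-tao-ladder
rung1/STAGE3-BANACH.md §2, rung1/KERNEL-STAGE3-PLAN.md §6]
-/

noncomputable section

namespace Summit.NavierStokesRegularity.NavierStokesRegularity.Theorems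

namespace DSSOneShift

open Set MeasureTheory intervalIntegral
open Literature.Analysis.FluidPDE Literature.Analysis.FluidPDE.TaoCascade CertificateGlueOn

variable {m : ℕ}

namespace OneShiftFrame

variable (F : OneShiftFrame m)

/-- (TABLE-SPARSE RATE VERSION of `exists_surviving_dssWave_of_windowCert_v3`: the rate rows read `quadTermLip ε₀ α A A i k ≤ 2 R k` on the tail shells.) **KERNEL STAGE 3 — end-to-end with the tail side fully derived.** Hypotheses are now: the window
certificate; WINDOW-SIDE numbers in solved form (raw window block `q`-Lipschitz; `γ`, `Z₀`, `Dwin`; window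
amplitudes `A` on window shells; the wake entry `A₁`; the raw window output in the box = (H-win); the
renormalisation-factor enclosure); TABLE ARITHMETIC rows (rates `R` dominate the amplitude expression; the
contraction rows; the self-map rows = STAGE 2 Lemma 4; the centre mismatch `dev`); and the FRAME inequalities
(tube amplitudes, wake tubes under `Qβⁿ`, top tubes under `C₀ϱ^{W+j}`, a bottom box interval avoiding `0`, a
point of the invariant set). Conclusion: a non-trivial (S₁)-surviving admissible DSS wave.
[cite: Tao2016AveragedNS, §4 Lemma 4.1 (4.8), §5.3–§6; cell vocabulary, harvest/h2-tao-ladder rung1/STAGE2-LEMMA.md, rung1/STAGE3-BANACH.md, rung1/KERNEL-STAGE3-PLAN.md] -/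
theorem exists_surviving_dssWave_of_windowCert_v3s {ε₀ Mα Q β C₀ ϱ q gHi γ Z0 A1 : ℝ}
    {α : Fin m → Fin m → Fin m → ℤ × ℤ × ℤ → ℝ} (cert : OneShiftWindowCert F ε₀ α)
    (R A Dwin devC : ℤ → ℝ)
    (hε : 0 < 1 + ε₀) (hMα : 0 ≤ Mα) (hα : ∀ i₁ i₂ i₃ μ, |α i₁ i₂ i₃ μ| ≤ Mα) (hW1 : 1 ≤ F.W)
    (hq : 0 ≤ q) (hq1 : q < 1) (hA0 : ∀ k, 0 ≤ A k)
    (hAtail : ∀ j k', ¬ F.InWindow k' → |F.tubeC j k'| + F.tubeR k' ≤ A k')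
    (hAwin : ∀ w, F.Adm w → ∀ j k', F.InWindow k' → ∀ s ∈ Icc 0 F.τhi, |F.fullFamily cert w j k' s| ≤ A k')
    (hRrow : ∀ i k, ¬ F.InWindow k → quadTermLip ε₀ α A A i k ≤ 2 * R k) (hR0 : ∀ k, 0 ≤ R k)
    (hg0 : ∀ w, F.Adm w → 0 ≤ gfac (slice (F.fullFamily cert w) (F.decodeTau w)) ∧
      gfac (slice (F.fullFamily cert w) (F.decodeTau w)) ≤ gHi)
    (hγ : ∀ u v, F.AdmLip R u → F.AdmLip R v →
      |gfac (slice (F.fullFamily cert u) (F.decodeTau u)) -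
        gfac (slice (F.fullFamily cert v) (F.decodeTau v))| ≤ γ * dist u v)
    (hZ0 : ∀ u v, F.AdmLip R u → F.AdmLip R v → ∀ i,
      |F.fullFamily cert u i 0 (F.decodeTau u) - F.fullFamily cert v i 0 (F.decodeTau v)| ≤ Z0 * dist u v)
    (hDwin : ∀ u v, F.AdmLip R u → F.AdmLip R v → ∀ j k', F.InWindow k' → ∀ s ∈ Icc 0 F.τhi,
      |F.fullFamily cert u j k' s - F.fullFamily cert v j k' s| ≤ Dwin k' * dist u v)
    (hrow : ∀ i k, ¬ F.InWindow k →
      gHi * (if F.InWindow (k + 1) then Z0 else F.wt (k + 1) + R (k + 1) * F.rτ) + A (k + 1) * γ +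
        F.τhi * quadTermLip ε₀ α A (fun k' => if F.InWindow k' then Dwin k' else F.wt k') i k ≤
        q * F.wt k)
    (hW : ∀ u v, F.AdmLip R u → F.AdmLip R v →
      dist (F.rawWindow cert u) (F.rawWindow cert v) ≤ q * dist u v)
    (h0 : ∃ u, F.AdmLip R u)
    (hwinIn : ∀ u, F.AdmLip R u →
      (∀ i k, |(F.rawWindow cert u).1 i k| ≤ 1) ∧ |(F.rawWindow cert u).2| ≤ 1)
    (hdev : ∀ w, F.Adm w → ∀ i k, ¬ F.InWindow k → ¬ F.InWindow (k + 1) →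
      |gfac (slice (F.fullFamily cert w) (F.decodeTau w)) * F.tubeC i (k + 1) - F.tubeC i k| ≤ devC k)
    (hA1 : ∀ w, F.Adm w → ∀ i,
      |gfac (slice (F.fullFamily cert w) (F.decodeTau w)) * F.fullFamily cert w i 0 (F.decodeTau w) -
        F.tubeC i (-1)| ≤ A1)
    (hrows : ∀ k, ¬ F.InWindow k → ¬ F.InWindow (k + 1) →
      gHi * F.tubeR (k + 1) + devC k + F.τhi * R k ≤ F.tubeR k)
    (hrow1 : A1 + F.τhi * R (-1) ≤ F.tubeR (-1))
    (hg : ∀ u, F.AdmLip R u →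
      1 < gfac (slice (F.fullFamily cert u) (F.decodeTau u)) ^ 2 ∧
        gfac (slice (F.fullFamily cert u) (F.decodeTau u)) ^ 2 ≤ 1 + ε₀ ∧
        gfac (slice (F.fullFamily cert u) (F.decodeTau u)) < bigLam ε₀ ∧
        β ^ 2 < gfac (slice (F.fullFamily cert u) (F.decodeTau u)) * bigLam ε₀)
    (hQA : A 0 ≤ Q) (hβ1 : 1 ≤ β)
    (hwakeTube : ∀ i (n : ℕ), 1 ≤ n → |F.tubeC i (-(n : ℤ))| + F.tubeR (-(n : ℤ)) ≤ Q * β ^ n)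
    (hϱ : 0 < ϱ) (hϱ1 : ϱ * bigLam ε₀ < 1) (hC₀ : 0 ≤ C₀)
    (htopTube : ∀ i (j : ℕ), |F.tubeC i ((F.W : ℤ) + j)| + F.tubeR ((F.W : ℤ) + j) ≤ C₀ * ϱ ^ (F.W + j))
    (hne : ∃ i, F.a i 0 < |F.yc i 0|) :
    ∃ (T : ℝ) (Φ : Unit → ℝ → Em m), 0 < T ∧ IsDSSWave ε₀ α (Equiv.refl Unit) T Φ ∧ Surviving 1 ε₀ T ∧
      ∃ x, Φ () x ≠ 0 := by
  have hA : ∀ w, F.Adm w → ∀ j k', ∀ s ∈ Icc 0 F.τhi, |F.fullFamily cert w j k' s| ≤ A k' :=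
    fun w hw j k' s hs => F.abs_fullFamily_le_of_tubes cert A hAtail hAwin hw j k' hs
  have hR : ∀ u, F.Adm u → ∀ i k, ¬ F.InWindow k → ∀ s ∈ Icc 0 F.τhi,
      |quadTerm ε₀ α (F.fullFamily cert u) i k s| ≤ R k :=
    fun u hu i k hk s hs => F.abs_quadTerm_fullFamily_le_of_quadTermLip cert hε R A hA hRrow hu i hk hs
  have htailIn : ∀ u, F.AdmLip R u → ∀ i k, ¬ F.InWindow k → ∀ t ∈ Icc 0 F.τhi,
      |F.tailRaw cert u i k t - F.tubeC i k| ≤ F.tubeR k :=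
    fun u hu i k hk t ht => F.tailRaw_mem_tube_of_rows cert R devC hR hg0 hdev hA1 hrows hrow1 hu.1 i hk ht
  have hhull0 : ∀ u, F.AdmLip R u → ∀ i, ∀ s ∈ Icc 0 F.τhi, |F.fullFamily cert u i 0 s| ≤ Q :=
    fun u hu i s hs => (hAwin u hu.1 i 0 ⟨le_rfl, by exact_mod_cast hW1⟩ s hs).trans hQA
  exact F.exists_surviving_dssWave_of_windowCert_rows cert R A Dwin hε hMα hα hW1 hq hq1 hR0 hR hA hg0 hγ hZ0
    hDwin hrow hW h0 hwinIn htailIn hg ((hA0 0).trans hQA) hβ1 hwakeTube hhull0 hϱ hϱ1 hC₀ htopTube hne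

/-- (TABLE-SPARSE RATE VERSION of `exists_surviving_dssWave_of_windowCert_v4`.) **KERNEL STAGE 3 — end-to-end, window side in the engine's EDGE FORM.** As `…_v3` (p623026) with the four
window-side Lipschitz hypotheses replaced by their primitive edge forms: the raw window block (`Z, S_b, S_e`),
the renormalisation factor (`γ_x, γ_b, γ_e`), the window bottom at the moving flight time (`dz₀, χ_b, χ_e`),
and every window shell along the flight (`vmax, χ^b_max, χ^e_max` per shell). [cite: Tao2016AveragedNS, §4 Lemma 4.1 (4.8), §5.3–§6; cell vocabulary, harvest/h2-tao-ladder rung1/STAGE3-BANACH.md §2 (H-lip (a)–(e)), rung1/KERNEL-STAGE3-PLAN.md §6] -/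
theorem exists_surviving_dssWave_of_windowCert_v4s {ε₀ Mα Q β C₀ ϱ q gHi A1 : ℝ}
    {Z Sb Se γx γb γe dz0 χb χe : ℝ}
    {α : Fin m → Fin m → Fin m → ℤ × ℤ × ℤ → ℝ} (cert : OneShiftWindowCert F ε₀ α)
    (R A devC vmax χbm χem : ℤ → ℝ)
    (hε : 0 < 1 + ε₀) (hMα : 0 ≤ Mα) (hα : ∀ i₁ i₂ i₃ μ, |α i₁ i₂ i₃ μ| ≤ Mα) (hW1 : 1 ≤ F.W)
    (hq : 0 ≤ q) (hq1 : q < 1) (hA0 : ∀ k, 0 ≤ A k)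
    (hAtail : ∀ j k', ¬ F.InWindow k' → |F.tubeC j k'| + F.tubeR k' ≤ A k')
    (hAwin : ∀ w, F.Adm w → ∀ j k', F.InWindow k' → ∀ s ∈ Icc 0 F.τhi, |F.fullFamily cert w j k' s| ≤ A k')
    (hRrow : ∀ i k, ¬ F.InWindow k → quadTermLip ε₀ α A A i k ≤ 2 * R k) (hR0 : ∀ k, 0 ≤ R k)
    (hg0 : ∀ w, F.Adm w → 0 ≤ gfac (slice (F.fullFamily cert w) (F.decodeTau w)) ∧
      gfac (slice (F.fullFamily cert w) (F.decodeTau w)) ≤ gHi)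
    -- window side, EDGE FORM (the engine's STAGE3 lines)
    (hWedge : ∀ u v, F.AdmLip R u → F.AdmLip R v → ∀ B E : ℝ,
      (∀ i, ∀ t ∈ Icc 0 F.τhi, |F.decodeTail u i (-1) t - F.decodeTail v i (-1) t| ≤ B) →
      (∀ i, ∀ t ∈ Icc 0 F.τhi, |F.decodeTail u i F.W t - F.decodeTail v i F.W t| ≤ E) →
        dist (F.rawWindow cert u) (F.rawWindow cert v) ≤ Z * dist u v + Sb * B + Se * E)
    (hγedge : ∀ u v, F.AdmLip R u → F.AdmLip R v → ∀ B E : ℝ,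
      (∀ i, ∀ t ∈ Icc 0 F.τhi, |F.decodeTail u i (-1) t - F.decodeTail v i (-1) t| ≤ B) →
      (∀ i, ∀ t ∈ Icc 0 F.τhi, |F.decodeTail u i F.W t - F.decodeTail v i F.W t| ≤ E) →
        |gfac (slice (F.fullFamily cert u) (F.decodeTau u)) -
          gfac (slice (F.fullFamily cert v) (F.decodeTau v))| ≤ γx * dist u v + γb * B + γe * E)
    (hZedge : ∀ u v, F.AdmLip R u → F.AdmLip R v → ∀ i, ∀ B E : ℝ,
      (∀ i, ∀ t ∈ Icc 0 F.τhi, |F.decodeTail u i (-1) t - F.decodeTail v i (-1) t| ≤ B) →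
      (∀ i, ∀ t ∈ Icc 0 F.τhi, |F.decodeTail u i F.W t - F.decodeTail v i F.W t| ≤ E) →
        |F.fullFamily cert u i 0 (F.decodeTau u) - F.fullFamily cert v i 0 (F.decodeTau v)| ≤
          dz0 * dist u v + χb * B + χe * E)
    (hDedge : ∀ u v, F.AdmLip R u → F.AdmLip R v → ∀ j k', F.InWindow k' → ∀ s ∈ Icc 0 F.τhi, ∀ B E : ℝ,
      (∀ i, ∀ t ∈ Icc 0 F.τhi, |F.decodeTail u i (-1) t - F.decodeTail v i (-1) t| ≤ B) →
      (∀ i, ∀ t ∈ Icc 0 F.τhi, |F.decodeTail u i F.W t - F.decodeTail v i F.W t| ≤ E) →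
        |F.fullFamily cert u j k' s - F.fullFamily cert v j k' s| ≤ vmax k' * dist u v + χbm k' * B + χem k' * E)
    -- rows with the solved-form constants substituted
    (hqX : Z + Sb * F.wt (-1) + Se * F.wt F.W ≤ q)
    (hrow : ∀ i k, ¬ F.InWindow k →
      gHi * (if F.InWindow (k + 1) then dz0 + χb * F.wt (-1) + χe * F.wt F.W
          else F.wt (k + 1) + R (k + 1) * F.rτ) + A (k + 1) * (γx + γb * F.wt (-1) + γe * F.wt F.W) +
        F.τhi * quadTermLip ε₀ α A
          (fun k' => if F.InWindow k' then vmax k' + χbm k' * F.wt (-1) + χem k' * F.wt F.W else F.wt k') i k ≤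
        q * F.wt k)
    (h0 : ∃ u, F.AdmLip R u)
    (hwinIn : ∀ u, F.AdmLip R u →
      (∀ i k, |(F.rawWindow cert u).1 i k| ≤ 1) ∧ |(F.rawWindow cert u).2| ≤ 1)
    (hdev : ∀ w, F.Adm w → ∀ i k, ¬ F.InWindow k → ¬ F.InWindow (k + 1) →
      |gfac (slice (F.fullFamily cert w) (F.decodeTau w)) * F.tubeC i (k + 1) - F.tubeC i k| ≤ devC k)
    (hA1 : ∀ w, F.Adm w → ∀ i,
      |gfac (slice (F.fullFamily cert w) (F.decodeTau w)) * F.fullFamily cert w i 0 (F.decodeTau w) -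
        F.tubeC i (-1)| ≤ A1)
    (hrows : ∀ k, ¬ F.InWindow k → ¬ F.InWindow (k + 1) →
      gHi * F.tubeR (k + 1) + devC k + F.τhi * R k ≤ F.tubeR k)
    (hrow1 : A1 + F.τhi * R (-1) ≤ F.tubeR (-1))
    (hg : ∀ u, F.AdmLip R u →
      1 < gfac (slice (F.fullFamily cert u) (F.decodeTau u)) ^ 2 ∧
        gfac (slice (F.fullFamily cert u) (F.decodeTau u)) ^ 2 ≤ 1 + ε₀ ∧
        gfac (slice (F.fullFamily cert u) (F.decodeTau u)) < bigLam ε₀ ∧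
        β ^ 2 < gfac (slice (F.fullFamily cert u) (F.decodeTau u)) * bigLam ε₀)
    (hQA : A 0 ≤ Q) (hβ1 : 1 ≤ β)
    (hwakeTube : ∀ i (n : ℕ), 1 ≤ n → |F.tubeC i (-(n : ℤ))| + F.tubeR (-(n : ℤ)) ≤ Q * β ^ n)
    (hϱ : 0 < ϱ) (hϱ1 : ϱ * bigLam ε₀ < 1) (hC₀ : 0 ≤ C₀)
    (htopTube : ∀ i (j : ℕ), |F.tubeC i ((F.W : ℤ) + j)| + F.tubeR ((F.W : ℤ) + j) ≤ C₀ * ϱ ^ (F.W + j))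
    (hne : ∃ i, F.a i 0 < |F.yc i 0|) :
    ∃ (T : ℝ) (Φ : Unit → ℝ → Em m), 0 < T ∧ IsDSSWave ε₀ α (Equiv.refl Unit) T Φ ∧ Surviving 1 ε₀ T ∧
      ∃ x, Φ () x ≠ 0 := by
  refine F.exists_surviving_dssWave_of_windowCert_v3s cert R A
    (fun k' => vmax k' + χbm k' * F.wt (-1) + χem k' * F.wt F.W) devC hε hMα hα hW1 hq hq1 hA0 hAtail hAwin
    hRrow hR0 hg0 ?_ ?_ ?_ hrow ?_ h0 hwinIn hdev hA1 hrows hrow1 hg hQA hβ1 hwakeTube hϱ hϱ1 hC₀ htopTube hne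
  · intro u v hu hv
    exact F.lipschitz_of_edgeForm u v (hγedge u v hu hv)
  · intro u v hu hv i
    exact F.lipschitz_of_edgeForm u v (hZedge u v hu hv i)
  · intro u v hu hv j k' hk' s hs
    exact F.lipschitz_of_edgeForm u v (hDedge u v hu hv j k' hk' s hs)
  · intro u v hu hv
    have h := F.lipschitz_of_edgeForm u v (hWedge u v hu hv)
    exact h.trans (mul_le_mul_of_nonneg_right hqX dist_nonneg)

end OneShiftFrame

end DSSOneShift

end Summit.NavierStokesRegularity.NavierStokesRegularity.Theorems
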